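import Mathlib
import HarnessLib
import Literature.Analysis.FluidPDE.ClassicalSolution
import Literature.Analysis.FluidPDE.LerayHopf
import Literature.Analysis.FluidPDE.SuitableWeak
import Literature.Analysis.FluidPDE.NSCriticalClosureBesovKatoClass
import Summits.NavierStokesRegularity.Statement
import Summits.NavierStokesRegularity.NavierStokesRegularity.Theses.QuarterJolt
import Summits.NavierStokesRegularity.NavierStokesRegularity.Theorems.QuarterJoltTypeIFlatCell
import Summits.NavierStokesRegularity.NavierStokesRegularity.Theorems.NoBlowupToClay
import Summits.NavierStokesRegularity.NavierStokesRegularity.Theorems.LerayQuarterDissipationRecordTimeTypeI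

/-!
# Route QuarterJolt — crux `NoTerminalJolt` (stmt-NavierStokesRegularity-26463), LEAD line
# `regular_split`: the TYPE-I TERMINAL JOLT LAW and the typed edges
# `NoTerminalJolt ⇒ NoTypeIBlowup` (item 1217) and `NoTypeII (item 0056) ∧ NoTerminalJolt ⇒ Clay (A)`

Seat ns-ntj-p1 g2 (LEAD of the crux; `--supports 26463 --as helper`). Second of two files; the
analysis is in `QuarterJoltTypeIFlatCell` (the route's two supports re-run under the plain Type-I
rate `IsTypeIBlowup u T` instead of the slice law).

THE STATEMENTS (frame of the crux: `ν > 0`, `T > 0`, `(u, p)` classical on `[0, T) × ℝ³`, Leray–Hopf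
on `[0, T]` from the rapidly decaying datum `u 0`; jolt functional
`D(t) = (√(T−t))⁻¹ ∫‖u(t) − u(T)‖²`, `u(T)` the Leray–Hopf terminal value):

* `NoTerminalJolt.hasSmoothExtensionPast_of_isTypeIBlowup_of_tendsto_joltFunctional` — continuation
  criterion: Type-I rate at `T` + `D → 0` ⇒ the solution extends smoothly past `T`
  (ε-regularity contrapositive `exists_singularPoint_of_classical_of_not_hasSmoothExtensionPast`,
  Lemarié-Rieusset 2016 Thm. 15.1 (C), then the two Type-I supports);
* `NoTerminalJolt.typeI_terminalJoltLaw` — **every Type-I first blow-up jolts**: maximal at `T` +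
  Type-I rate ⇒ `D ↛ 0`; `typeI_exists_frequently_le_joltFunctional` — `limsup_{t↑T} D(t) > 0`;
  `not_isTypeIBlowup_of_tendsto_joltFunctional` — at a first blow-up time, no terminal jolt excludes
  the Type-I rate. The landed `terminalJoltLaw` (p619871, slice law) is the special case
  slice law ⇒ Type I (`RecordTimeTypeI.main`); the edge law (`NoTerminalJolt.edgeLaw`, p626911) still
  needs the slice law for its UPPER bound.
* `noTypeIBlowup_of_noTerminalJolt` — the crux BY NAME implies the shelf statement
  stmt-NavierStokesRegularity-1217 `NoTypeIBlowup` VERBATIM (its type is that item's signature, so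
  `exact noTypeIBlowup_of_noTerminalJolt h` closes every route's copy GIVEN the crux): **NTJ is at
  least as strong as the exclusion of Type-I blow-up for Clay data.**
* `noBlowup_of_noTypeII_of_noTerminalJolt` / `navierStokesRegularity_of_noTypeII_of_noTerminalJolt`
  — with the shelf statement stmt-0056 `NoTypeII` VERBATIM as hypothesis (every first blow-up in the
  frame is Type I), the crux gives `NoBlowup` (stmt-0054 verbatim) and Clay (A)
  (`navierStokesRegularity_of_noBlowup`, stmt-0055, landed). Since `EnstrophyQuarterLaw ⇒ NoTypeII`
  (`noTypeII_of_enstrophyQuarterLaw`, by `RecordTimeTypeI.main`), this WEAKENS the hypothesis of the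
  route's assembly `EQL ∧ NTJ ⇒ Clay (A)` (`Theses.QuarterJolt.closes`) from EQL to NoTypeII.

POSITION OF THE CRUX, now kernel-hard: `NoBlowup (0054) ⇒ NTJ ⇒ NoTypeIBlowup (1217)`, and
`NTJ ∧ NoTypeII (0056) ⇒ NoBlowup`; the open residue of line `regular_split` at first blow-up times
splits into the Type-I half (= item 1217 exactly, by `typeI_terminalJoltLaw`) and the Type-II half
(a non-Type-I first blow-up approaching `u(T)` at `o((T−t)^{1/4})` in `L²`).

HONEST FRAMING: conditional statements about HYPOTHETICAL blow-ups. Nothing here proves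
`NoTerminalJolt` (stmt-26463), `EnstrophyQuarterLaw` (stmt-1574), `NoTypeIBlowup` (stmt-1217),
`NoTypeII` (stmt-0056), `NoBlowup` (stmt-0054) or Navier–Stokes regularity — all OPEN, and this file
claims no progress on them. No summit statement is proved here. Lint note: importing
`LerayQuarterDissipationRecordTimeTypeI` (→ `Theses.LerayQuarterDissipation`) carries the known
`theses-cone` advisory, as for the route's other landed files. [folklore]
-/

noncomputable section

-- the summit and its single sub-problem share the name (CONVENTIONS §1), as in every Theorems file
set_option linter.dupNamespace false

namespace Summit.NavierStokesRegularity.NavierStokesRegularity.Theorems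

open MeasureTheory Set Function Filter Topology
open scoped NNReal ENNReal
open Literature.Analysis.FluidPDE

namespace NoTerminalJolt

/-- **Continuation criterion, Type-I form.** In the frame of the route (classical on `[0,T)`,
Leray–Hopf on `[0,T]`, rapidly decaying datum), the Type-I rate `‖u(t,x)‖ ≤ C/√(T−t)` near `T` and NO
terminal jolt at `T` force a smooth extension past `T`: otherwise
`exists_singularPoint_of_classical_of_not_hasSmoothExtensionPast` gives a singular vertex `(T, x₀)`,
`JoltFlatCell.main_of_isTypeIBlowup` makes its scaled cell energy vanish and
`NoFlatCellVertex.main_of_isTypeIBlowup` refutes it. [folklore] -/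
theorem hasSmoothExtensionPast_of_isTypeIBlowup_of_tendsto_joltFunctional {ν T : ℝ} (hν : 0 < ν)
    (hT : 0 < T) {u : ℝ → EuclideanSpace ℝ (Fin 3) → EuclideanSpace ℝ (Fin 3)}
    {p : ℝ → EuclideanSpace ℝ (Fin 3) → ℝ}
    (hcl : IsClassicalNSSolutionOn (Ico 0 T) ν 0 u p) (hLH : IsLerayHopfOn T ν 0 (u 0) u)
    (hdec : HasRapidSpatialDecay (u 0)) (hTI : IsTypeIBlowup u T)
    (hJ : Tendsto (fun t : ℝ => (Real.sqrt (T - t))⁻¹ * ∫ x, ‖u t x - u T x‖ ^ 2)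
      (𝓝[<] T) (𝓝 0)) :
    HasSmoothExtensionPast ν 0 u T := by
  by_contra hext
  obtain ⟨x₀, hx₀⟩ :=
    exists_singularPoint_of_classical_of_not_hasSmoothExtensionPast hν hT hcl hLH hdec hext
  exact NoFlatCellVertex.main_of_isTypeIBlowup hν hT hcl hLH hTI x₀
    (fun ε hε => JoltFlatCell.main_of_isTypeIBlowup hT hLH hTI hJ x₀ hε) hx₀

/-- **The Type-I terminal jolt law: every Type-I first blow-up jolts.** A MAXIMAL classical solution
on `[0, T)` (first blow-up at `T`), Leray–Hopf on `[0, T]` from a rapidly decaying datum, which blows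
up at most at the Type-I rate `‖u(t)‖_∞ ≤ C/√(T−t)`, has a jolt functional
`(√(T−t))⁻¹ ∫‖u(t) − u(T)‖²` that does NOT tend to `0` as `t ↑ T` (it approaches its terminal state
at the self-similar `L²` rate along some times). Generalises `terminalJoltLaw` (slice law ⇒ Type I).
[folklore] -/
theorem typeI_terminalJoltLaw {ν T : ℝ} (hν : 0 < ν) (hT : 0 < T)
    {u : ℝ → EuclideanSpace ℝ (Fin 3) → EuclideanSpace ℝ (Fin 3)}
    {p : ℝ → EuclideanSpace ℝ (Fin 3) → ℝ}
    (hmax : IsMaximalSmoothSolution ν 0 u p T) (hLH : IsLerayHopfOn T ν 0 (u 0) u)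
    (hdec : HasRapidSpatialDecay (u 0)) (hTI : IsTypeIBlowup u T) :
    ¬ Tendsto (fun t : ℝ => (Real.sqrt (T - t))⁻¹ * ∫ x, ‖u t x - u T x‖ ^ 2)
      (𝓝[<] T) (𝓝 0) :=
  fun hJ => hmax.2
    (hasSmoothExtensionPast_of_isTypeIBlowup_of_tendsto_joltFunctional hν hT hmax.1 hLH hdec hTI hJ)

/-- **The Type-I terminal jolt law, `limsup` form**: under the hypotheses of `typeI_terminalJoltLaw`
there is `ε > 0` with `(√(T−t))⁻¹ ∫‖u(t) − u(T)‖² ≥ ε` for `t < T` arbitrarily close to `T`, i.e.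
`limsup_{t ↑ T} (T−t)^{−1/2} ‖u(t) − u(T)‖₂² > 0`. [folklore] -/
theorem typeI_exists_frequently_le_joltFunctional {ν T : ℝ} (hν : 0 < ν) (hT : 0 < T)
    {u : ℝ → EuclideanSpace ℝ (Fin 3) → EuclideanSpace ℝ (Fin 3)}
    {p : ℝ → EuclideanSpace ℝ (Fin 3) → ℝ}
    (hmax : IsMaximalSmoothSolution ν 0 u p T) (hLH : IsLerayHopfOn T ν 0 (u 0) u)
    (hdec : HasRapidSpatialDecay (u 0)) (hTI : IsTypeIBlowup u T) :
    ∃ ε : ℝ, 0 < ε ∧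
      ∃ᶠ t in 𝓝[<] T, ε ≤ (Real.sqrt (T - t))⁻¹ * ∫ x, ‖u t x - u T x‖ ^ 2 := by
  by_contra h
  push Not at h
  refine typeI_terminalJoltLaw hν hT hmax hLH hdec hTI
    (tendsto_order.2 ⟨fun a ha => ?_, fun b hb => ?_⟩)
  · exact Eventually.of_forall fun t => ha.trans_le
      (mul_nonneg (inv_nonneg.2 (Real.sqrt_nonneg _)) (integral_nonneg fun _ => sq_nonneg _))
  · exact h b hb

/-- **No terminal jolt at a first blow-up time excludes the Type-I rate**: a maximal classical
Leray–Hopf solution from a rapidly decaying datum whose jolt functional tends to `0` at its blow-up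
time `T` is NOT a Type-I blow-up. [folklore] -/
theorem not_isTypeIBlowup_of_tendsto_joltFunctional {ν T : ℝ} (hν : 0 < ν) (hT : 0 < T)
    {u : ℝ → EuclideanSpace ℝ (Fin 3) → EuclideanSpace ℝ (Fin 3)}
    {p : ℝ → EuclideanSpace ℝ (Fin 3) → ℝ}
    (hmax : IsMaximalSmoothSolution ν 0 u p T) (hLH : IsLerayHopfOn T ν 0 (u 0) u)
    (hdec : HasRapidSpatialDecay (u 0))
    (hJ : Tendsto (fun t : ℝ => (Real.sqrt (T - t))⁻¹ * ∫ x, ‖u t x - u T x‖ ^ 2)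
      (𝓝[<] T) (𝓝 0)) :
    ¬ IsTypeIBlowup u T :=
  fun hTI => typeI_terminalJoltLaw hν hT hmax hLH hdec hTI hJ

end NoTerminalJolt

/-- **`NoTerminalJolt ⇒ NoTypeIBlowup`** (crux stmt-26463 BY NAME ⇒ shelf statement stmt-1217
VERBATIM — the conclusion is that item's signature, so `exact noTypeIBlowup_of_noTerminalJolt h`
discharges every route's copy `NoTypeIBlowup` / `TypeIExclusion` / `Target` given the crux): in the
frame, a solution blowing up at most at the Type-I rate at `T` extends smoothly past `T`. So the crux
is at least as strong as the (open) exclusion of Type-I blow-up for Clay data. Conditional on the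
OPEN crux; nothing is asserted about either statement. [folklore] -/
theorem noTypeIBlowup_of_noTerminalJolt (hJ : Theses.QuarterJolt.NoTerminalJolt) :
    ∀ (ν T : ℝ), 0 < ν → 0 < T →
      ∀ (u : ℝ → EuclideanSpace ℝ (Fin 3) → EuclideanSpace ℝ (Fin 3))
        (p : ℝ → EuclideanSpace ℝ (Fin 3) → ℝ),
        Literature.Analysis.FluidPDE.IsClassicalNSSolutionOn (Set.Ico 0 T) ν 0 u p →
        Literature.Analysis.FluidPDE.IsLerayHopfOn T ν 0 (u 0) u →
        Literature.Analysis.FluidPDE.HasRapidSpatialDecay (u 0) →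
        Literature.Analysis.FluidPDE.IsTypeIBlowup u T →
        Literature.Analysis.FluidPDE.HasSmoothExtensionPast ν 0 u T := by
  intro ν T hν hT u p hcl hLH hdec hTI
  exact NoTerminalJolt.hasSmoothExtensionPast_of_isTypeIBlowup_of_tendsto_joltFunctional hν hT hcl
    hLH hdec hTI (hJ ν T hν hT u p hcl hLH hdec)

/-- **`NoTypeII ∧ NoTerminalJolt ⇒ NoBlowup`** (shelf statement stmt-0056 VERBATIM as hypothesis,
crux stmt-26463 BY NAME, conclusion = shelf statement stmt-0054 VERBATIM): if every first blow-up in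
the frame is Type I, and no solution in the frame has a terminal jolt, then no first blow-up exists —
a Type-I one would jolt (`NoTerminalJolt.typeI_terminalJoltLaw`). Conditional on two OPEN statements;
nothing is asserted about them. [folklore] -/
theorem noBlowup_of_noTypeII_of_noTerminalJolt
    (h56 : ∀ (ν T : ℝ), 0 < ν → 0 < T →
      ∀ (u : ℝ → EuclideanSpace ℝ (Fin 3) → EuclideanSpace ℝ (Fin 3))
        (p : ℝ → EuclideanSpace ℝ (Fin 3) → ℝ),
        Literature.Analysis.FluidPDE.IsMaximalSmoothSolution ν 0 u p T →
        Literature.Analysis.FluidPDE.IsLerayHopfOn T ν 0 (u 0) u →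
        Literature.Analysis.FluidPDE.HasRapidSpatialDecay (u 0) →
        Literature.Analysis.FluidPDE.IsTypeIBlowup u T)
    (hJ : Theses.QuarterJolt.NoTerminalJolt) :
    ∀ (ν T : ℝ), 0 < ν → 0 < T →
      ∀ (u : ℝ → EuclideanSpace ℝ (Fin 3) → EuclideanSpace ℝ (Fin 3))
        (p : ℝ → EuclideanSpace ℝ (Fin 3) → ℝ),
        Literature.Analysis.FluidPDE.IsClassicalNSSolutionOn (Set.Ico 0 T) ν 0 u p →
        Literature.Analysis.FluidPDE.IsLerayHopfOn T ν 0 (u 0) u →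
        Literature.Analysis.FluidPDE.HasRapidSpatialDecay (u 0) →
        Literature.Analysis.FluidPDE.HasSmoothExtensionPast ν 0 u T := by
  intro ν T hν hT u p hcl hLH hdec
  by_contra hext
  exact NoTerminalJolt.typeI_terminalJoltLaw hν hT ⟨hcl, hext⟩ hLH hdec
    (h56 ν T hν hT u p ⟨hcl, hext⟩ hLH hdec) (hJ ν T hν hT u p hcl hLH hdec)

/-- **`NoTypeII ∧ NoTerminalJolt ⇒ Clay (A)`**: the previous theorem composed with the landed frame
theorem `navierStokesRegularity_of_noBlowup` (stmt-0055). Compared with the route's assembly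
`Theses.QuarterJolt.closes : EnstrophyQuarterLaw → NoTerminalJolt → … → NavierStokesRegularity`, the
hypothesis `EnstrophyQuarterLaw` (slice quarter law at every first blow-up) is WEAKENED to `NoTypeII`
(Type-I sup-rate at every first blow-up; `noTypeII_of_enstrophyQuarterLaw`). Conditional on two OPEN
statements; no summit statement is proved. [folklore] -/
theorem navierStokesRegularity_of_noTypeII_of_noTerminalJolt
    (h56 : ∀ (ν T : ℝ), 0 < ν → 0 < T →
      ∀ (u : ℝ → EuclideanSpace ℝ (Fin 3) → EuclideanSpace ℝ (Fin 3))
        (p : ℝ → EuclideanSpace ℝ (Fin 3) → ℝ),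
        Literature.Analysis.FluidPDE.IsMaximalSmoothSolution ν 0 u p T →
        Literature.Analysis.FluidPDE.IsLerayHopfOn T ν 0 (u 0) u →
        Literature.Analysis.FluidPDE.HasRapidSpatialDecay (u 0) →
        Literature.Analysis.FluidPDE.IsTypeIBlowup u T)
    (hJ : Theses.QuarterJolt.NoTerminalJolt) : NavierStokesRegularity :=
  navierStokesRegularity_of_noBlowup (noBlowup_of_noTypeII_of_noTerminalJolt h56 hJ)

/-- **`EnstrophyQuarterLaw ⇒ NoTypeII`** (route crux stmt-1574 BY NAME ⇒ shelf statement stmt-0056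
VERBATIM): the slice quarter law at a first blow-up time forces the Type-I sup-rate there
(`RecordTimeTypeI.main`, item 22145, landed). Records that the hypothesis of
`navierStokesRegularity_of_noTypeII_of_noTerminalJolt` is implied by the route's. Conditional on the
OPEN crux EQL. [folklore] -/
theorem noTypeII_of_enstrophyQuarterLaw (hQ : Theses.QuarterJolt.EnstrophyQuarterLaw) :
    ∀ (ν T : ℝ), 0 < ν → 0 < T →
      ∀ (u : ℝ → EuclideanSpace ℝ (Fin 3) → EuclideanSpace ℝ (Fin 3))
        (p : ℝ → EuclideanSpace ℝ (Fin 3) → ℝ),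
        Literature.Analysis.FluidPDE.IsMaximalSmoothSolution ν 0 u p T →
        Literature.Analysis.FluidPDE.IsLerayHopfOn T ν 0 (u 0) u →
        Literature.Analysis.FluidPDE.HasRapidSpatialDecay (u 0) →
        Literature.Analysis.FluidPDE.IsTypeIBlowup u T := by
  intro ν T hν hT u p hmax hLH hdec
  obtain ⟨K, hK⟩ := hQ ν T hν hT u p hmax hLH hdec
  exact RecordTimeTypeI.main hν hT hmax.1 hLH hdec K hK

end Summit.NavierStokesRegularity.NavierStokesRegularity.Theorems

end
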